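import Literature.AlgebraicGeometry.HodgeTheory.AbelianVarietyEndAlgebraIdempotentsSubvarieties
import Literature.AlgebraicGeometry.HodgeTheory.AbelianVarietyEndAlgebraCommutativeCriterion
import HarnessLib

/-!
# Simplicity of an abelian variety read off its endomorphism algebra and its lattice of abelian subvarieties:
# `X` simple ⟺ exactly two abelian subvarieties ⟺ `End⁰(X)` has no idempotents besides `0`, `1` ⟺ `End⁰(X)` simple and reduced
# (Mumford §19 Cor. 1–2; Lange 2023 Cor. 2.4.26; Lam FC (22.1))

Layer `Literature/AlgebraicGeometry/HodgeTheory`; theorems only (no `def`, no instance, no named fact; net debt 0).  The tree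
already has «`X` simple ⟺ `End⁰ X` a division algebra ⟺ `End⁰ X` has no zero divisors» (perfect field:
`ComplexMultiplication/FieldOfDegreeTwoDimSimple.isSimple_iff_forall_exists_mul_eq_one ∕ isSimple_iff_noZeroDivisors_endAlgebra`,
`Motives/AbelianVarietySimpleOfEndAlgebraDomain`) and «`End⁰ X` simple ⟺ `X` isotypic»
(`HodgeTheory/AbelianVarietyCyclotomicAutomorphismCrossedProductIsotypicCriterion.isSimpleRing_endAlgebra_iff_exists_isIsogenous_biproduct_const`);
this file adds the characterisations through IDEMPOTENTS, through the NUMBER OF ABELIAN SUBVARIETIES, and through the pair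
(simple ring, reduced): in `End⁰ X = ⊕_i M_{n_i}(D_i)` (Mumford §19 Cor. 2), `X` is simple iff `r = 1` and `n_1 = 1`.
§1 holds over ANY field, §2 over a PERFECT field (Poincaré reducibility; isotypic components).

THE PRINT.  Mumford, *Abelian Varieties* (1970) §19 Cor. 1–2 of Thm. 1 (pp. 173–174) and the definition p. 174; Lange, *Abelian
Varieties over the Complex Numbers* (2023) §2.4.4 Cor. 2.4.26 (PDF p. 124: `End_ℚ(X) ≃ M_{n_1}(F_1) ⊕ ⋯ ⊕ M_{n_r}(F_r)`); Lam,
*A First Course in Noncommutative Rings* §22 Prop. (22.1) (p. 326); Zarhin 2008 Thm. 3.2 (p. 7) for the finiteness of abelian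
subvarieties.

Results (namespace `Literature.AlgebraicGeometry.HodgeTheory.AbelianVariety`):
* §1 (any field) **`isIdempotentElem_endAlgebra_iff_of_isSimple`** (the idempotents of `End⁰` of a simple `X` are `0`, `1`),
  `setOf_isIdempotentElem_endAlgebra_of_isSimple`;
* §2 (perfect field, `0 < dim X`) **`isSimple_iff_natCard_setOf_range_subvariety_eq_two`** (simple ⟺ exactly two abelian
  subvarieties), **`isSimple_iff_forall_isIdempotentElem_endAlgebra`** (simple ⟺ `End⁰ X` has only the idempotents `0`, `1`),
  `isSimple_iff_ncard_setOf_isIdempotentElem_endAlgebra_eq_two`, **`isSimple_iff_isSimpleRing_and_isReduced_endAlgebra`**,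
  `isSimple_iff_isSimpleRing_endAlgebra_and_finite_setOf_range_subvariety`, `isSimple_iff_isSimpleRing_endAlgebra_and_isReduced_end`.

## References
* [MumfordAV1970] D. Mumford, *Abelian Varieties* (1970), §19 Thm. 1, Cor. 1–2 (pp. 173–174).
* [Lange2023AbelianVarietiesComplex] H. Lange, *Abelian Varieties over the Complex Numbers* (2023), §2.4.4 Cor. 2.4.26 (PDF p. 124).
* [Lam2001FirstCourse] T. Y. Lam, *A First Course in Noncommutative Rings*, 2nd ed. (2001), §22 Prop. (22.1) p. 326.
* [Zarhin2008HomomorphismsFiniteFields] Yu. G. Zarhin, *Homomorphisms of abelian varieties over finite fields* (2008), Thm. 3.2 (p. 7).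
-/

noncomputable section

universe u

open CategoryTheory CategoryTheory.Limits

namespace Literature.AlgebraicGeometry.HodgeTheory

namespace AbelianVariety

open _root_.AlgebraicGeometry
open Literature.AlgebraicGeometry.Motives Literature.AlgebraicGeometry.Motives.AbelianVariety

variable {K : Type u} [Field K]

/-! ## §1 Idempotents of `End⁰` of a simple abelian variety (any field) -/

section AnyField

variable {X : Motives.AbelianVariety K}

/-- **The idempotents of `End⁰ X` of a SIMPLE `X` are `0` and `1`** (any field; `End⁰ X` is a division algebra: an idempotent
`ε ≠ 0` with inverse `y` has `ε = ε (ε y) = ε² y = ε y = 1`). [cite: MumfordAV1970, §19 Cor. 2 of Thm. 1 (p. 174)] [cite: Lam2001FirstCourse, §22 Prop. (22.1) p. 326] -/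
theorem isIdempotentElem_endAlgebra_iff_of_isSimple (hX : X.IsSimple) {ε : X.endAlgebra} :
    IsIdempotentElem ε ↔ ε = 0 ∨ ε = 1 := by
  refine ⟨fun hε ↦ ?_, ?_⟩
  · by_cases h0 : ε = 0
    · exact Or.inl h0
    · obtain ⟨y, hy, -⟩ := Literature.AlgebraicGeometry.ComplexMultiplication.endAlgebra_exists_inv_of_isSimple hX ε h0
      refine Or.inr ?_
      calc ε = ε * (ε * y) := by rw [hy, mul_one]
        _ = ε * ε * y := (mul_assoc _ _ _).symm
        _ = 1 := by rw [hε.eq, hy]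
  · rintro (h | h)
    · rw [h]; exact IsIdempotentElem.zero
    · rw [h]; exact IsIdempotentElem.one

/-- For a simple `X` of positive dimension the set of idempotents of `End⁰ X` is `{0, 1}` (any field).
[cite: MumfordAV1970, §19 Cor. 2 of Thm. 1 (p. 174)] -/
theorem setOf_isIdempotentElem_endAlgebra_of_isSimple (hX : X.IsSimple) :
    {ε : X.endAlgebra | IsIdempotentElem ε} = {0, 1} :=
  Set.ext fun _ ↦ isIdempotentElem_endAlgebra_iff_of_isSimple hX

end AnyField

/-! ## §2 Characterisations of simplicity over a perfect field -/

section Perfect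

variable [PerfectField K] {X : Motives.AbelianVariety K}

/-- **`X` IS SIMPLE IFF IT HAS EXACTLY TWO ABELIAN SUBVARIETIES** (`0` and `X`; perfect field, `0 < dim X`): a finite lattice forces
`X ∼ ⨁_{q<r} B_q` with `2^r` members, and `2^r = 2` iff `r = 1`, i.e. `X ∼ B_0` simple. [cite: MumfordAV1970, §19 Cor. 1–2 of Thm. 1 and definition (pp. 173–174)]
[cite: Zarhin2008HomomorphismsFiniteFields, Thm. 3.2 (p. 7)] -/
theorem isSimple_iff_natCard_setOf_range_subvariety_eq_two (hX0 : 0 < X.dim) :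
    X.IsSimple ↔ Nat.card {R : Set X.X.left | ∃ (Z : Motives.AbelianVariety K) (j : Z ⟶ X),
        IsClosedImmersion (Hom.toSchemeHom j) ∧ R = Set.range (Hom.toSchemeHom j)} = 2 := by
  refine ⟨fun hX ↦ natCard_setOf_range_subvariety_of_isSimple hX hX0, fun h2 ↦ ?_⟩
  have hfin : {R : Set X.X.left | ∃ (Z : Motives.AbelianVariety K) (j : Z ⟶ X),
      IsClosedImmersion (Hom.toSchemeHom j) ∧ R = Set.range (Hom.toSchemeHom j)}.Finite :=
    Set.finite_coe_iff.1 (Nat.finite_of_card_ne_zero (by rw [h2]; exact two_ne_zero))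
  obtain ⟨r, B, hB, hB0, hni, hX⟩ := (finite_setOf_range_subvariety_iff_exists_isIsogenous_biproduct_simple X).1 hfin
  rw [natCard_setOf_range_subvariety_of_isIsogenous_biproduct_simple hB hB0 hni hX, Fintype.card_fin] at h2
  have hr : r = 1 := Nat.pow_right_injective le_rfl (show 2 ^ r = 2 ^ 1 by rw [h2, pow_one])
  subst hr
  exact (hX.trans ⟨(biproductUniqueIso B).hom, isIsogeny_hom_of_iso _⟩).isSimple_symm (hB default)

/-- **`X` IS SIMPLE IFF `End⁰ X` HAS NO IDEMPOTENTS BESIDES `0` AND `1`** (perfect field, `0 < dim X`; `⟸`: a finite set of idempotents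
means finitely many abelian subvarieties, as many as idempotents, i.e. two). [cite: MumfordAV1970, §19 Cor. 1–2 of Thm. 1 (pp. 173–174)]
[cite: Lam2001FirstCourse, §22 Prop. (22.1) p. 326] -/
theorem isSimple_iff_forall_isIdempotentElem_endAlgebra (hX0 : 0 < X.dim) :
    X.IsSimple ↔ ∀ ε : X.endAlgebra, IsIdempotentElem ε → ε = 0 ∨ ε = 1 := by
  refine ⟨fun hX _ hε ↦ (isIdempotentElem_endAlgebra_iff_of_isSimple hX).1 hε, fun h ↦ ?_⟩
  haveI := nontrivial_endAlgebra_of_pos_dim hX0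
  have hset : {ε : X.endAlgebra | IsIdempotentElem ε} = {0, 1} := by
    refine Set.ext fun ε ↦ ⟨fun hε ↦ h ε hε, ?_⟩
    rintro (hε | hε)
    · rw [hε]; exact IsIdempotentElem.zero
    · rw [show ε = 1 from hε]; exact IsIdempotentElem.one
  have hfin : {ε : X.endAlgebra | IsIdempotentElem ε}.Finite := by
    rw [hset]
    exact (Set.finite_singleton 1).insert 0
  rw [isSimple_iff_natCard_setOf_range_subvariety_eq_two hX0,
    ← natCard_setOf_isIdempotentElem_endAlgebra_eq_natCard_setOf_range_subvariety X, Nat.card_coe_set_eq, hset]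
  exact Set.ncard_pair zero_ne_one

/-- `X` is simple iff `End⁰ X` has exactly two idempotents (perfect field, `0 < dim X`). [cite: MumfordAV1970, §19 Cor. 1–2 of Thm. 1 (pp. 173–174)]
[cite: Lam2001FirstCourse, §22 Prop. (22.1) p. 326] -/
theorem isSimple_iff_ncard_setOf_isIdempotentElem_endAlgebra_eq_two (hX0 : 0 < X.dim) :
    X.IsSimple ↔ {ε : X.endAlgebra | IsIdempotentElem ε}.ncard = 2 := by
  refine ⟨fun hX ↦ ncard_setOf_isIdempotentElem_endAlgebra_of_isSimple hX hX0, fun h2 ↦ ?_⟩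
  have hfin : {ε : X.endAlgebra | IsIdempotentElem ε}.Finite := Set.finite_of_ncard_ne_zero (by rw [h2]; exact two_ne_zero)
  rw [isSimple_iff_natCard_setOf_range_subvariety_eq_two hX0,
    ← natCard_setOf_isIdempotentElem_endAlgebra_eq_natCard_setOf_range_subvariety X, Nat.card_coe_set_eq, h2]

/-- **`X` IS SIMPLE IFF `End⁰ X` IS A SIMPLE RING AND REDUCED** (perfect field, `0 < dim X`): simple ring ⟺ isotypic `X ∼ C^{n+1}`,
reduced ⟺ multiplicity-free, together `X ∼ C` simple. [cite: MumfordAV1970, §19 Cor. 1–2 of Thm. 1 (pp. 173–174)]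
[cite: Lange2023AbelianVarietiesComplex, §2.4.4 Cor. 2.4.26 with proof (PDF p. 124)] -/
theorem isSimple_iff_isSimpleRing_and_isReduced_endAlgebra (hX0 : 0 < X.dim) :
    X.IsSimple ↔ IsSimpleRing X.endAlgebra ∧ IsReduced X.endAlgebra := by
  refine ⟨fun hX ↦ ⟨isSimpleRing_endAlgebra_of_isSimple_of_dim_pos hX hX0,
    Literature.AlgebraicGeometry.ComplexMultiplication.isReduced_endAlgebra_of_isSimple hX⟩, fun ⟨hS, hR⟩ ↦ ?_⟩
  haveI := hS
  obtain ⟨C, n, hC, hC0, hX⟩ := isSimpleRing_endAlgebra_iff_exists_isIsogenous_biproduct_const.1 hS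
  rcases Nat.eq_zero_or_pos n with rfl | hn
  · have hX₁ : IsIsogenous X (⨁ fun _ : Fin 1 ↦ C) := hX
    exact (hX₁.trans ⟨(biproductUniqueIso fun _ : Fin 1 ↦ C).hom, isIsogeny_hom_of_iso _⟩).isSimple_symm hC
  · have hX' : IsIsogenous X (⨁ fun _ : Fin 1 ↦ ⨁ fun _ : Fin (n + 1) ↦ C) :=
      hX.trans ⟨(biproductUniqueIso fun _ : Fin 1 ↦ ⨁ fun _ : Fin (n + 1) ↦ C).inv, isIsogeny_hom_of_iso (biproductUniqueIso _).symm⟩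
    have hinf := infinite_setOf_range_subvariety_of_isIsogenous_biproduct_powers (B := fun _ : Fin 1 ↦ C)
      (m := fun _ ↦ n + 1) hX' (q := 0) (by omega) hC0
    exact (hinf ((finite_setOf_range_subvariety_iff_isReduced_endAlgebra X).2 hR)).elim

/-- `X` is simple iff `End⁰ X` is a simple ring and `X` has finitely many abelian subvarieties (isotypic and multiplicity-free;
perfect field, `0 < dim X`). [cite: MumfordAV1970, §19 Cor. 1–2 of Thm. 1 (pp. 173–174)] [cite: Zarhin2008HomomorphismsFiniteFields, Thm. 3.2 (p. 7)] -/
theorem isSimple_iff_isSimpleRing_endAlgebra_and_finite_setOf_range_subvariety (hX0 : 0 < X.dim) :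
    X.IsSimple ↔ IsSimpleRing X.endAlgebra ∧ {R : Set X.X.left | ∃ (Z : Motives.AbelianVariety K) (j : Z ⟶ X),
        IsClosedImmersion (Hom.toSchemeHom j) ∧ R = Set.range (Hom.toSchemeHom j)}.Finite := by
  rw [isSimple_iff_isSimpleRing_and_isReduced_endAlgebra hX0, finite_setOf_range_subvariety_iff_isReduced_endAlgebra]

/-- `X` is simple iff `End⁰ X` is a simple ring and the order `End X` is reduced (perfect field, `0 < dim X`).
[cite: MumfordAV1970, §19 Cor. 1–2 of Thm. 1 and Thm. 3 (pp. 173–176)] -/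
theorem isSimple_iff_isSimpleRing_endAlgebra_and_isReduced_end (hX0 : 0 < X.dim) :
    X.IsSimple ↔ IsSimpleRing X.endAlgebra ∧ _root_.IsReduced (End X) := by
  rw [isSimple_iff_isSimpleRing_and_isReduced_endAlgebra hX0, isReduced_endAlgebra_iff_isReduced_end]

end Perfect

end AbelianVariety

end Literature.AlgebraicGeometry.HodgeTheory

end
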